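import Summits.CriticalPhenomena.PercolationContinuityZ3.Theorems.Transplant.SkelFrmQuasiBParamsFaceFloorsLXA
import Summits.CriticalPhenomena.PercolationContinuityZ3.Theorems.Transplant.SkelFrmBParamsFaceFloorsLXA
import Summits.CriticalPhenomena.PercolationContinuityZ3.Theorems.Transplant.SkelFrmQuasiBParamsFaceCountsShiftA
import Summits.CriticalPhenomena.PercolationContinuityZ3.Theorems.Transplant.SkelFrmBParamsFaceCountsShiftA
import Summits.CriticalPhenomena.PercolationContinuityZ3.Theorems.Transplant.PlanarSkeletonFrmQuasiDefs
import Summits.CriticalPhenomena.PercolationContinuityZ3.Theorems.Transplant.PlanarSkeletonFrmDefs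
import Summits.CriticalPhenomena.PercolationContinuityZ3.Theorems.Transplant.SkelPhiStepIDataNS
import Summits.CriticalPhenomena.PercolationContinuityZ3.Theorems.Transplant.SkelFrmQuasi1ChoiceDefs
import Summits.CriticalPhenomena.PercolationContinuityZ3.Theorems.Transplant.SkelFrmQuasi1ParamsLBL
import Summits.CriticalPhenomena.PercolationContinuityZ3.Theorems.Transplant.SkelFrmQuasi1ParamsPO
import Summits.CriticalPhenomena.PercolationContinuityZ3.Theorems.Transplant.SkelFrmQuasiBChoiceNums
import Summits.CriticalPhenomena.PercolationContinuityZ3.Theorems.Transplant.SkelFrmQuasiBChoiceWindow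
import Summits.CriticalPhenomena.PercolationContinuityZ3.Theorems.Transplant.SkelFrmQuasiBParamsFaceFloorsClrXA
import Summits.CriticalPhenomena.PercolationContinuityZ3.Theorems.Transplant.SkelFrmQuasiBParamsFaceFloorsTXA
import Summits.CriticalPhenomena.PercolationContinuityZ3.Theorems.Transplant.SkelFrmQuasiBParamsFaceRunA
import Summits.CriticalPhenomena.PercolationContinuityZ3.Theorems.Transplant.SkelFrmQuasiBParamsFaceUnits
import Summits.CriticalPhenomena.PercolationContinuityZ3.Theorems.Transplant.SkelFrmQuasiBParamsFineSizeA
import Summits.CriticalPhenomena.PercolationContinuityZ3.Theorems.Transplant.SkelFrmQuasiBParamsLF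
import Summits.CriticalPhenomena.PercolationContinuityZ3.Theorems.Transplant.SkelFrmQuasi1SlotTypes
import HarnessLib
import Summits.CriticalPhenomena.PercolationContinuityZ3.Theorems.Transplant.SkelFrmBParamsFaceFloorsL2XA
/-!
# GEN-Q PORT (WAVE-Q table v0.8 section 2, row G197, U-level L20; captain R-6/R-7 2026-08-27: carrier token swap `PlanarSkeletonFrmFrom ↦ PlanarSkeletonFrmQuasi`)
# of the tree module «Transplant/SkelFrmFromBParamsFaceFloorsL2XA» (sha256 26294a0a0b8125b8…) onto the quasi-step carrier `PlanarSkeletonFrmQuasi` (p507026): «SkelFrmQuasiBParamsFaceFloorsL2XA»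

HAND HUNK (L-FLOORMAP-1 ①⑥ / L-KitS-1 reader side; G017 «SkelFrmQuasiBChoiceNums», hp-8's KitSN): KS0.R'0→KS0.R'0N×11 — the kit of record at window cost `KS.NQ Φ`.

ORIGINAL TITLE: (F) VALUE LAYER, N2 twin (hp-8 g42, 2026-08-23; F-DISCHARGE-MAP-N2 G18 x-face TRANSVERSE landing floors FL3/FL4 = delta (Δ1)): `port_frm.py` text of N1

builds on p205010 (kernel theorem, internal audit signed; external expert review pending) — nothing in this file uses p205010; NOTHING is claimed about any open node
((N3-b), the end state).  Lane `prim-bschramm`, seat `prim-bschramm-stmt` (gen 33; GEN-Q column pen; tool = captain gen-1 g4's port_genq.py R-14 --cone + p3-g30's T1 patch).  Helper file (`--supports stmt-CriticalPhenomena-4575 --as helper`).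
PORT RULES (U-wave r1–r4 re-used, GEN-Q hunk classes of p3-g29 #6136): declaration order, names and proof texts are those of «SkelFrmFromBParamsFaceFloorsL2XA», byte-identical except
(i) the carrier token `PlanarSkeletonFrmFrom ↦ PlanarSkeletonFrmQuasi` in binders, `namespace`/`end` lines and qualified names (module names `SkelFrmFrom… ↦ SkelFrmQuasi…`
in imports of already-ported rows); (ii) `Φ.step ↦ Φ.qstep` with the called Steps lemma replaced by its `…Q`/`_q` twin and the cost `Φ.M` threaded (none in this file unless
listed below); (iii) `Φ.cyl_connected ↦ Φ.cyl_reach` readers (none unless listed); (iv) graph-ball radii / window floors ×`Φ.M` (none unless listed).  Carrier-free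
residents stay imported/exported from the original «SkelFrmBParamsFaceFloorsL2XA» exactly as in the FrmFrom port.  Docstrings and citations are the original's.

-/

noncomputable section

open scoped Classical

namespace Summit.CriticalPhenomena.PercolationContinuityZ3.Theorems.Transplant

namespace PlanarSkeletonFrmQuasi

namespace NegB

open Literature.Probability.Percolation Literature.Probability.LatticeModels SimpleGraph
open Literature.Probability.Percolation.KozmaNitzan.Cells (oth sgOf sgOf_sign)
open SkelConc (Consts)
open Skelφ (shearUnit shearUnit_pos yCoreLoS yCoreHiS yCSLo yCSHi crossOffX)
open Skelφ.StepI (DataN)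
open TwoAxis.Para (modulus coarse lam0 lam1)
open Neg

namespace KS

section FloorsL2

/-- **The transverse master envelope**: `u₁·(nℓ + U·Z) ≤ m·(10Kq·u₁ − 2u₁ − 5)` with `Z := 2k + (1000Kq + k)·RA′ + 6`, under
`11·(2k + (k + 1000Kq)·RA′ + 8) ≤ 2ℓ_L`. [folklore] -/
theorem envT (κ : Consts) {V : Type} [DecidableEq V] [Countable V] {G : SimpleGraph V} [G.LocallyFinite] (Φ : PlanarSkeletonFrmQuasi G) (t : V) (p : unitInterval) (D : Skelφ.StepI.DataNS V) (g : ℕ) (f : ℕ) (mk : ℕ) (hN : EqNumL κ Φ t p D g f) (hκ : (hL κ Φ t p D g f).natAbs ≤ 10 * nL κ Φ t p D g f) (hu2 : 2 ≤ u₁A κ Φ t p D g f) {k : ℕ}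
    (hℓ : 11 * (2 * (k : ℤ) + ((k : ℤ) + 1000 * Neg.Kq κ) * (KS0.R'0N κ Φ (KS.NQ Φ) t p D mk : ℤ) + 8) ≤ 2 * (ℓL κ Φ t p D g f : ℤ)) :
    u₁A κ Φ t p D g f * ((nL κ Φ t p D g f : ℤ) * (ℓL κ Φ t p D g f : ℤ) +
        (shearUnit (nL κ Φ t p D g f) (hL κ Φ t p D g f) : ℤ) * (2 * (k : ℤ) + (1000 * (Neg.Kq κ : ℤ) + k) * (KS0.R'0N κ Φ (KS.NQ Φ) t p D mk : ℤ) + 6)) ≤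
      modulus (nL κ Φ t p D g f) (hL κ Φ t p D g f) (vL κ Φ t p D g f) (vβL κ Φ t p D g f) * (8 * u₁A κ Φ t p D g f - 2 * u₁A κ Φ t p D g f - 5) := by
  obtain ⟨hn1, hℓ1⟩ := one_le_of_eqNumL κ Φ t p D g f hN
  have hm1 := modulus_gt κ Φ t p D g f hN
  obtain ⟨hU1, hU2⟩ := clr_shearUnit_bounds κ Φ t p D g f hκ
  have hu : 1 ≤ u₁A κ Φ t p D g f := (units_eqA κ Φ t p D g f).2.2.2.2.2
  have hq : (1 : ℤ) ≤ Neg.Kq κ := by exact_mod_cast Neg.one_le_Kq κ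
  have hn1' : (1 : ℤ) ≤ (nL κ Φ t p D g f : ℤ) := by exact_mod_cast hn1
  have hℓ1' : (1 : ℤ) ≤ (ℓL κ Φ t p D g f : ℤ) := by exact_mod_cast hℓ1
  set n : ℤ := (nL κ Φ t p D g f : ℤ)
  set ℓ : ℤ := (ℓL κ Φ t p D g f : ℤ)
  set m := modulus (nL κ Φ t p D g f) (hL κ Φ t p D g f) (vL κ Φ t p D g f) (vβL κ Φ t p D g f)
  set U : ℤ := (shearUnit (nL κ Φ t p D g f) (hL κ Φ t p D g f) : ℤ)
  set u := u₁A κ Φ t p D g f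
  set Q : ℤ := (Neg.Kq κ : ℤ)
  set R : ℤ := (KS0.R'0N κ Φ (KS.NQ Φ) t p D mk : ℤ)
  have hk0 : (0 : ℤ) ≤ k := by positivity
  have hR0 : 0 ≤ R := by positivity
  have hZ0 : 0 ≤ 2 * (k : ℤ) + (1000 * Q + k) * R + 6 := by positivity
  -- `U·Z ≤ 11n·Z ≤ n·(2ℓ − 22)`, `m·X ≥ n(ℓ − 1)·X`, `X := 8u − 2u − 5 = 6u − 5` (N2 window `8u₁`; needs `u ≥ 2`)
  have h1 : U * (2 * (k : ℤ) + (1000 * Q + k) * R + 6) ≤ 11 * n * (2 * (k : ℤ) + (1000 * Q + k) * R + 6) := mul_le_mul_of_nonneg_right hU2 hZ0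
  have eZ : ((k : ℤ) + 1000 * Q) * R = (1000 * Q + k) * R := by ring
  have hZ : 11 * (2 * (k : ℤ) + (1000 * Q + k) * R + 6) ≤ 2 * ℓ - 22 := by rw [← eZ]; linarith
  have h1' : 11 * n * (2 * (k : ℤ) + (1000 * Q + k) * R + 6) ≤ n * (2 * ℓ - 22) := by
    have := mul_le_mul_of_nonneg_left hZ (by linarith : (0 : ℤ) ≤ n); linarith
  have hX0 : 0 ≤ 8 * u - 2 * u - 5 := by linarith
  have h2 : (n * (ℓ - 1)) * (8 * u - 2 * u - 5) ≤ m * (8 * u - 2 * u - 5) := mul_le_mul_of_nonneg_right hm1.le hX0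
  have h5 : u * (U * (2 * (k : ℤ) + (1000 * Q + k) * R + 6)) ≤ u * (n * (2 * ℓ - 22)) := mul_le_mul_of_nonneg_left (h1.trans h1') (by linarith)
  have g1 : 0 ≤ (u - 2) * (n * ℓ) := mul_nonneg (by linarith) (by positivity)
  have g2 : 0 ≤ n * ℓ := by positivity
  have g3 : 0 ≤ u * n := by nlinarith
  nlinarith [h2, h5, g1, g2, g3]

/-- `U·⌊(nℓ − U + 1)/U⌋ ≥ nℓ − 2U + 2` and `U·(⌊nℓ/U⌋ + 1) ≤ nℓ + U`, `⌊(nℓ − U + 1)/U⌋ ≤ ⌊nℓ/U⌋ + 1`. [folklore] -/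
theorem strideS_bounds (κ : Consts) {V : Type} [DecidableEq V] [Countable V] {G : SimpleGraph V} [G.LocallyFinite] (Φ : PlanarSkeletonFrmQuasi G) (t : V) (p : unitInterval) (D : Skelφ.StepI.DataNS V) (g : ℕ) (f : ℕ) (hN : EqNumL κ Φ t p D g f) :
    (nL κ Φ t p D g f : ℤ) * (ℓL κ Φ t p D g f : ℤ) - 2 * (shearUnit (nL κ Φ t p D g f) (hL κ Φ t p D g f) : ℤ) + 2 ≤
        (shearUnit (nL κ Φ t p D g f) (hL κ Φ t p D g f) : ℤ) *
          (((nL κ Φ t p D g f : ℤ) * (ℓL κ Φ t p D g f) - (shearUnit (nL κ Φ t p D g f) (hL κ Φ t p D g f) : ℕ) + 1) / (shearUnit (nL κ Φ t p D g f) (hL κ Φ t p D g f) : ℕ)) ∧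
      (shearUnit (nL κ Φ t p D g f) (hL κ Φ t p D g f) : ℤ) * ((nL κ Φ t p D g f : ℤ) * (ℓL κ Φ t p D g f) / (shearUnit (nL κ Φ t p D g f) (hL κ Φ t p D g f) : ℕ) + 1) ≤
        (nL κ Φ t p D g f : ℤ) * (ℓL κ Φ t p D g f : ℤ) + (shearUnit (nL κ Φ t p D g f) (hL κ Φ t p D g f) : ℤ) ∧
      ((nL κ Φ t p D g f : ℤ) * (ℓL κ Φ t p D g f) - (shearUnit (nL κ Φ t p D g f) (hL κ Φ t p D g f) : ℕ) + 1) / (shearUnit (nL κ Φ t p D g f) (hL κ Φ t p D g f) : ℕ) ≤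
        (nL κ Φ t p D g f : ℤ) * (ℓL κ Φ t p D g f) / (shearUnit (nL κ Φ t p D g f) (hL κ Φ t p D g f) : ℕ) + 1 := by
  obtain ⟨hn1, -⟩ := one_le_of_eqNumL κ Φ t p D g f hN
  have hU0 : 0 < (shearUnit (nL κ Φ t p D g f) (hL κ Φ t p D g f) : ℤ) := shearUnit_pos hn1 _
  set U : ℤ := (shearUnit (nL κ Φ t p D g f) (hL κ Φ t p D g f) : ℤ)
  set N : ℤ := (nL κ Φ t p D g f : ℤ) * (ℓL κ Φ t p D g f)
  obtain ⟨a1, a2⟩ := PlanarSkeletonNeg.NegB.RootArith.floor_sandwich (x := N - U + 1) (d := U) hU0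
  obtain ⟨b1, b2⟩ := PlanarSkeletonNeg.NegB.RootArith.floor_sandwich (x := N) (d := U) hU0
  refine ⟨by linarith, by nlinarith, ?_⟩
  have : U * ((N - U + 1) / U) < U * (N / U + 1 + 1) := by nlinarith
  have := lt_of_mul_lt_mul_left this hU0.le
  omega

/-- **Lower-core envelope**: `m·(u₁k + 2u₁ + 5 − b₀₁) + u₁·U ≤ u₁·(U·yCoreLoS k) + 1` (`b₀₁ = 10Kq·u₁`). [folklore] -/
theorem coreLo_env (κ : Consts) {V : Type} [DecidableEq V] [Countable V] {G : SimpleGraph V} [G.LocallyFinite] (Φ : PlanarSkeletonFrmQuasi G) (t : V) (p : unitInterval) (D : Skelφ.StepI.DataNS V) (g : ℕ) (f : ℕ) (mk : ℕ) (hN : EqNumL κ Φ t p D g f) (hκ : (hL κ Φ t p D g f).natAbs ≤ 10 * nL κ Φ t p D g f) (hu2 : 2 ≤ u₁A κ Φ t p D g f) {k : ℕ}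
    (hℓ : 11 * (2 * (k : ℤ) + ((k : ℤ) + 1000 * Neg.Kq κ) * (KS0.R'0N κ Φ (KS.NQ Φ) t p D mk : ℤ) + 8) ≤ 2 * (ℓL κ Φ t p D g f : ℤ)) :
    modulus (nL κ Φ t p D g f) (hL κ Φ t p D g f) (vL κ Φ t p D g f) (vβL κ Φ t p D g f) *
          (u₁A κ Φ t p D g f * k + 2 * u₁A κ Φ t p D g f + 5 - ((NegB.BSlot.small κ Φ t p D g f 1 : ℕ) : ℤ)) +
        u₁A κ Φ t p D g f * (shearUnit (nL κ Φ t p D g f) (hL κ Φ t p D g f) : ℤ) ≤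
      u₁A κ Φ t p D g f * ((shearUnit (nL κ Φ t p D g f) (hL κ Φ t p D g f) : ℤ) *
          yCoreLoS (nL κ Φ t p D g f) (ℓL κ Φ t p D g f) (hL κ Φ t p D g f) (qB3XA κ Φ t p D g f (KS0.R'0N κ Φ (KS.NQ Φ) t p D mk)) (KS0.R'0N κ Φ (KS.NQ Φ) t p D mk) k) + 1 := by
  obtain ⟨hn1, hℓ1⟩ := one_le_of_eqNumL κ Φ t p D g f hN
  obtain ⟨hm1, hm2⟩ := Skelφ.NegPrm.modulus_vβOf hn1 (hL κ Φ t p D g f) (ℓL κ Φ t p D g f) (vL κ Φ t p D g f)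
  obtain ⟨hU1, hU2⟩ := clr_shearUnit_bounds κ Φ t p D g f hκ
  obtain ⟨hs1, hs2, -⟩ := strideS_bounds κ Φ t p D g f hN
  have henv := envT κ Φ t p D g f mk hN hκ hu2 hℓ
  have hu : 1 ≤ u₁A κ Φ t p D g f := (units_eqA κ Φ t p D g f).2.2.2.2.2
  have hb : ((NegB.BSlot.small κ Φ t p D g f 1 : ℕ) : ℤ) = 8 * u₁A κ Φ t p D g f := by rw [(NegB.small_eq κ Φ t p D g f).2]; unfold u₁A; push_cast; ring
  have hq : (1 : ℤ) ≤ Neg.Kq κ := by exact_mod_cast Neg.one_le_Kq κ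
  have hn1' : (1 : ℤ) ≤ (nL κ Φ t p D g f : ℤ) := by exact_mod_cast hn1
  rw [hb]
  unfold Skelφ.yCoreLoS qB3XA Wrun
  push_cast
  set n : ℤ := (nL κ Φ t p D g f : ℤ)
  set ℓ : ℤ := (ℓL κ Φ t p D g f : ℤ)
  set m := modulus (nL κ Φ t p D g f) (hL κ Φ t p D g f) (vL κ Φ t p D g f) (vβL κ Φ t p D g f) with hm
  set U : ℤ := (shearUnit (nL κ Φ t p D g f) (hL κ Φ t p D g f) : ℤ)
  set u := u₁A κ Φ t p D g f
  set Q : ℤ := (Neg.Kq κ : ℤ)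
  set R : ℤ := (KS0.R'0N κ Φ (KS.NQ Φ) t p D mk : ℤ)
  set sLo : ℤ := (n * ℓ - U + 1) / U
  set W' : ℤ := n * ℓ / U + 1
  have hmvβ : modulus (nL κ Φ t p D g f) (hL κ Φ t p D g f) (vL κ Φ t p D g f) (Skelφ.NegPrm.vβOf (nL κ Φ t p D g f) (hL κ Φ t p D g f) (ℓL κ Φ t p D g f) (vL κ Φ t p D g f)) = m := rfl
  rw [hmvβ] at hm1 hm2
  have hk0 : (0 : ℤ) ≤ k := by positivity
  have hR0 : 0 ≤ R := by positivity
  have hm0 : 0 < m := by nlinarith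
  -- `U·(yCoreLoS k) = k·(U·sLo) − U·q₃ − k·U·R ≥ k(nℓ − 2U + 2) − U(W' + 1000QR + 2) − kUR`
  have hW : U * W' ≤ n * ℓ + U := hs2
  have h1 : (k : ℤ) * (U * sLo) ≥ (k : ℤ) * (n * ℓ - 2 * U + 2) := mul_le_mul_of_nonneg_left hs1 hk0
  have h2 : m * (u * k) ≤ (n * ℓ) * (u * k) := mul_le_mul_of_nonneg_right hm2 (by nlinarith)
  have e : u * (U * ((k : ℤ) * sLo - (W' + 1000 * Q * R + 2) - (k : ℤ) * R)) = u * ((k : ℤ) * (U * sLo)) - u * (U * W') - u * (U * (1000 * Q * R + 2)) - u * ((k : ℤ) * U * R) := by ring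
  rw [e]
  have h3 : u * ((k : ℤ) * (U * sLo)) ≥ u * ((k : ℤ) * (n * ℓ - 2 * U + 2)) := mul_le_mul_of_nonneg_left h1 (by linarith)
  have h4 : u * (U * W') ≤ u * (n * ℓ + U) := mul_le_mul_of_nonneg_left hW (by linarith)
  -- collect: need `u·(nℓ + U·(2k + 1000QR + kR + 4)) ≤ m·(10Qu − 2u − 5)`, which is `envT` (Z has `+6`)
  have h5 : u * (U * (2 * (k : ℤ) + (1000 * Q + k) * R + 4)) ≤ u * (U * (2 * (k : ℤ) + (1000 * Q + k) * R + 6)) :=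
    mul_le_mul_of_nonneg_left (mul_le_mul_of_nonneg_left (by linarith) (by linarith)) (by linarith)
  nlinarith

/-- **Upper-core envelope**: `u₁·(U·(yCoreHiS k + 1)) ≤ m·(u₁k + b₀₁ − 2u₁ − 5)`. [folklore] -/
theorem coreHi_env (κ : Consts) {V : Type} [DecidableEq V] [Countable V] {G : SimpleGraph V} [G.LocallyFinite] (Φ : PlanarSkeletonFrmQuasi G) (t : V) (p : unitInterval) (D : Skelφ.StepI.DataNS V) (g : ℕ) (f : ℕ) (mk : ℕ) (hN : EqNumL κ Φ t p D g f) (hκ : (hL κ Φ t p D g f).natAbs ≤ 10 * nL κ Φ t p D g f) (hu2 : 2 ≤ u₁A κ Φ t p D g f) {k : ℕ}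
    (hℓ : 11 * (2 * (k : ℤ) + ((k : ℤ) + 1000 * Neg.Kq κ) * (KS0.R'0N κ Φ (KS.NQ Φ) t p D mk : ℤ) + 8) ≤ 2 * (ℓL κ Φ t p D g f : ℤ)) :
    u₁A κ Φ t p D g f * ((shearUnit (nL κ Φ t p D g f) (hL κ Φ t p D g f) : ℤ) *
        (yCoreHiS (nL κ Φ t p D g f) (ℓL κ Φ t p D g f) (hL κ Φ t p D g f) (qB3XA κ Φ t p D g f (KS0.R'0N κ Φ (KS.NQ Φ) t p D mk)) (KS0.R'0N κ Φ (KS.NQ Φ) t p D mk) k + 1)) ≤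
      modulus (nL κ Φ t p D g f) (hL κ Φ t p D g f) (vL κ Φ t p D g f) (vβL κ Φ t p D g f) *
        (u₁A κ Φ t p D g f * k + ((NegB.BSlot.small κ Φ t p D g f 1 : ℕ) : ℤ) - 2 * u₁A κ Φ t p D g f - 5) := by
  obtain ⟨hn1, hℓ1⟩ := one_le_of_eqNumL κ Φ t p D g f hN
  obtain ⟨hm1, hm2⟩ := Skelφ.NegPrm.modulus_vβOf hn1 (hL κ Φ t p D g f) (ℓL κ Φ t p D g f) (vL κ Φ t p D g f)
  obtain ⟨hU1, hU2⟩ := clr_shearUnit_bounds κ Φ t p D g f hκ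
  obtain ⟨-, hs2, -⟩ := strideS_bounds κ Φ t p D g f hN
  have henv := envT κ Φ t p D g f mk hN hκ hu2 hℓ
  have hu : 1 ≤ u₁A κ Φ t p D g f := (units_eqA κ Φ t p D g f).2.2.2.2.2
  have hb : ((NegB.BSlot.small κ Φ t p D g f 1 : ℕ) : ℤ) = 8 * u₁A κ Φ t p D g f := by rw [(NegB.small_eq κ Φ t p D g f).2]; unfold u₁A; push_cast; ring
  have hq : (1 : ℤ) ≤ Neg.Kq κ := by exact_mod_cast Neg.one_le_Kq κ
  have hn1' : (1 : ℤ) ≤ (nL κ Φ t p D g f : ℤ) := by exact_mod_cast hn1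
  rw [hb]
  unfold Skelφ.yCoreHiS qB3XA Wrun
  push_cast
  set n : ℤ := (nL κ Φ t p D g f : ℤ)
  set ℓ : ℤ := (ℓL κ Φ t p D g f : ℤ)
  set m := modulus (nL κ Φ t p D g f) (hL κ Φ t p D g f) (vL κ Φ t p D g f) (vβL κ Φ t p D g f) with hm
  set U : ℤ := (shearUnit (nL κ Φ t p D g f) (hL κ Φ t p D g f) : ℤ)
  set u := u₁A κ Φ t p D g f
  set Q : ℤ := (Neg.Kq κ : ℤ)
  set R : ℤ := (KS0.R'0N κ Φ (KS.NQ Φ) t p D mk : ℤ)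
  set W' : ℤ := n * ℓ / U + 1
  have hmvβ : modulus (nL κ Φ t p D g f) (hL κ Φ t p D g f) (vL κ Φ t p D g f) (Skelφ.NegPrm.vβOf (nL κ Φ t p D g f) (hL κ Φ t p D g f) (ℓL κ Φ t p D g f) (vL κ Φ t p D g f)) = m := rfl
  rw [hmvβ] at hm1 hm2
  have hk0 : (0 : ℤ) ≤ k := by positivity
  have hR0 : 0 ≤ R := by positivity
  have hm0 : 0 < m := by nlinarith
  have hW : U * W' ≤ n * ℓ + U := hs2
  -- `U·(HiS + 1) = k·(U·W') + U·q₃ + k·U·R + U ≤ k(nℓ + U) + U(W' + 1000QR + 2) + kUR + U`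
  have e : u * (U * ((k : ℤ) * W' + (W' + 1000 * Q * R + 2) + (k : ℤ) * R + 1)) = u * ((k : ℤ) * (U * W')) + u * (U * W') + u * (U * (1000 * Q * R + 2)) + u * ((k : ℤ) * U * R) + u * U := by ring
  rw [e]
  have h1 : u * ((k : ℤ) * (U * W')) ≤ u * ((k : ℤ) * (n * ℓ + U)) := mul_le_mul_of_nonneg_left (mul_le_mul_of_nonneg_left hW hk0) (by linarith)
  have h4 : u * (U * W') ≤ u * (n * ℓ + U) := mul_le_mul_of_nonneg_left hW (by linarith)
  have h2 : (n * ℓ - n) * (u * k) ≤ m * (u * k) := mul_le_mul_of_nonneg_right hm1.le (by nlinarith)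
  have h6 : u * ((k : ℤ) * n) ≤ u * ((k : ℤ) * U) := mul_le_mul_of_nonneg_left (mul_le_mul_of_nonneg_left hU1 hk0) (by linarith)
  have h5 : u * (U * (2 * (k : ℤ) + (1000 * Q + k) * R + 4)) ≤ u * (U * (2 * (k : ℤ) + (1000 * Q + k) * R + 6)) :=
    mul_le_mul_of_nonneg_left (mul_le_mul_of_nonneg_left (by linarith) (by linarith)) (by linarith)
  nlinarith

/-- `yCoreLoS k ≤ yCoreHiS k`. [folklore] -/
theorem coreLo_le_Hi (κ : Consts) {V : Type} [DecidableEq V] [Countable V] {G : SimpleGraph V} [G.LocallyFinite] (Φ : PlanarSkeletonFrmQuasi G) (t : V) (p : unitInterval) (D : Skelφ.StepI.DataNS V) (g : ℕ) (f : ℕ) (hN : EqNumL κ Φ t p D g f) (q R' k : ℕ) :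
    yCoreLoS (nL κ Φ t p D g f) (ℓL κ Φ t p D g f) (hL κ Φ t p D g f) q R' k ≤ yCoreHiS (nL κ Φ t p D g f) (ℓL κ Φ t p D g f) (hL κ Φ t p D g f) q R' k := by
  obtain ⟨-, -, hs3⟩ := strideS_bounds κ Φ t p D g f hN
  unfold Skelφ.yCoreLoS Skelφ.yCoreHiS
  have hk0 : (0 : ℤ) ≤ k := by positivity
  have h1 := mul_le_mul_of_nonneg_left hs3 hk0
  have : (0 : ℤ) ≤ q := by positivity
  have : (0 : ℤ) ≤ (k : ℤ) * R' := by positivity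
  linarith

/-- The signed core ends at `τ = 1` and `τ = −1`. [folklore] -/
theorem yCS_eval (κ : Consts) {V : Type} [DecidableEq V] [Countable V] {G : SimpleGraph V} [G.LocallyFinite] (Φ : PlanarSkeletonFrmQuasi G) (t : V) (p : unitInterval) (D : Skelφ.StepI.DataNS V) (g : ℕ) (f : ℕ) (hN : EqNumL κ Φ t p D g f) (q R' k : ℕ) :
    yCSLo (nL κ Φ t p D g f) (ℓL κ Φ t p D g f) (hL κ Φ t p D g f) q R' 1 k = yCoreLoS (nL κ Φ t p D g f) (ℓL κ Φ t p D g f) (hL κ Φ t p D g f) q R' k ∧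
      yCSHi (nL κ Φ t p D g f) (ℓL κ Φ t p D g f) (hL κ Φ t p D g f) q R' 1 k = yCoreHiS (nL κ Φ t p D g f) (ℓL κ Φ t p D g f) (hL κ Φ t p D g f) q R' k ∧
      yCSLo (nL κ Φ t p D g f) (ℓL κ Φ t p D g f) (hL κ Φ t p D g f) q R' (-1) k = -yCoreHiS (nL κ Φ t p D g f) (ℓL κ Φ t p D g f) (hL κ Φ t p D g f) q R' k ∧
      yCSHi (nL κ Φ t p D g f) (ℓL κ Φ t p D g f) (hL κ Φ t p D g f) q R' (-1) k = -yCoreLoS (nL κ Φ t p D g f) (ℓL κ Φ t p D g f) (hL κ Φ t p D g f) q R' k := by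
  have h := coreLo_le_Hi κ Φ t p D g f hN q R' k
  unfold Skelφ.yCSLo Skelφ.yCSHi
  refine ⟨?_, ?_, ?_, ?_⟩
  · rw [one_mul, one_mul]; exact min_eq_left h
  · rw [one_mul, one_mul]; exact max_eq_right h
  · rw [neg_one_mul, neg_one_mul]; exact min_eq_right (by linarith)
  · rw [neg_one_mul, neg_one_mul]; exact max_eq_left (by linarith)

-- GEN-Q (R-2, captain 2026-08-27): `PlanarSkeletonFrmFrom.NegB.KS.FL3_XA_gen` is not in the used cone of the node top — not ported.

-- GEN-Q (R-2, captain 2026-08-27): `PlanarSkeletonFrmFrom.NegB.KS.FL4_XA_gen` is not in the used cone of the node top — not ported.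

-- GEN-Q (R-2, captain 2026-08-27): `PlanarSkeletonFrmFrom.NegB.KS.FL3_XA` is not in the used cone of the node top — not ported.

-- GEN-Q (R-2, captain 2026-08-27): `PlanarSkeletonFrmFrom.NegB.KS.FL4_XA` is not in the used cone of the node top — not ported.

end FloorsL2

end KS

end NegB

end PlanarSkeletonFrmQuasi

end Summit.CriticalPhenomena.PercolationContinuityZ3.Theorems.Transplant

end
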